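import Literature.MathematicalPhysics.QuantumFieldTheory.Balaban1983to89.B8Lemma1NonAbelian

/-!
# `Balaban1983to89.B8Ineq129` — B8 Sect. F (1.129) and the (1.137) clause of Proposition 6: the bond variables
# of the `k`-fold average in the GLOBAL AXIAL GAUGE ON A CUBE WITH CENTER `y`, `|Ū₀′ᵏ(x,x′) − 1| < |x − y|·2L²α₀`,
# `|(1/i) log Ū₀′ᵏ(x,x′)| < |x − y|·4α₀ ≤ 2dMα₀`, KERNEL-PROVED for NON-ABELIAN (`U1 𝔸 ⊇ U(N)`-valued) fields on
# the `ℤ^d` carriers of `B7Prop1Explicit`, base point `y` ANYWHERE (sign-general tree words)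

CITATION HEADER (lean-in-tree rule 2026-08-18).  Source of the STATEMENTS: T. Bałaban, *Spaces of regular gauge
field configurations on a lattice and gauge fixing conditions*, Commun. Math. Phys. **99**, 75–102 (1985)
[Balaban1985RegularSpaces] (cell paper B8; held `paper:balaban1985-cmp99-regular-spaces-gauge-fixing`, journal page
= PDF page + 74; quotations read this generation from the page renders p. 98 [PDF 24] and p. 99 [PDF 25]).
P. 98, verbatim: *"Let us consider the configuration U₀ on the cube □̃. By the assumptions (1.7)–(1.9) and
Proposition 2 from [3] we have |Ū₀ʲ(∂p) − 1| < 2α₀L²(Lʲη)², p ⊂ □̃^{(j)}, j = 0, 1, …, k. (1.128)  We apply a gauge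
transformation to U₀, such that the gauge transformed configuration U₀′ satisfies the axial gauge conditions
(1.15), and Ū₀′ᵏ satisfies the global axial gauge conditions on □̃^{(k)} of the type introduced in the proof of
Proposition 1 in [3], i.e. Ū₀′ᵏ(Γ_{y,x}) = 1 for x ∈ □̃^{(k)}, where y is a center of □̃^{(k)}. These last conditions
imply |Ū₀′ᵏ(x, x′) − 1| < |x − y|2L²α₀ ≤ (M + 4R₁M₁)dL²α₀, ⟨x, x′⟩ ⊂ □̃^{(k)}. (1.129)"* (□̃ a cube of side
`M + 4R₁M₁` in the unit `Lᵏη = 1` of the `k`-lattice, p. 98: *"A distance of its boundary to □ is equal to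
2R₁M₁"*, □ of size `MLʲη`, `j = k`).  P. 99, Proposition 6, verbatim: *"Let U₀, U₀′, □, □̃ be as described above,
and let 7dL²Mα₀ ≤ c₁. There exists a gauge transformation u defined on □̃ and such, that U₀^{u⁻¹} = U₁ = e^{iηA} on
□̃, (1.135) … Q_k(ηA) = (1/i) log Ū₀′ᵏ on □^{(k)}, |(1/i) log Ū₀′ᵏ(x, x′)| < |x − y|4α₀ ≤ 2dMα₀ for ⟨x, x′⟩ ⊂ □^{(k)},
y is a center of □, (1.137) …"* (the whole Proposition is typed verbatim, abstractly, as `B8.Prop6Printed`).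
The "proof of Proposition 1 in [3]" is [Balaban1985Averaging] = T. Bałaban, *Averaging operations for lattice gauge
theories*, Commun. Math. Phys. **98**, 17–51 (1985), pp. 24–25, verbatim: *"The conditions V₀(Γ_{y,x}) = 1 imply
V₀(x, x + e₁) = 1, |V₀(x, x + e₂) − 1| < |x₁ − y₁|α₀, …"*, kernel-typed on `ℤ^d` by unit b07 as
`B7Prop1Explicit.axial_bond_bound` (GLOBAL plaquette hypothesis (44), any `x, y`) and sharpened/localised by this
lineage as `B8Lemma1NonAbelian.axial_bond_bound_sharp` (LOCAL plaquette hypothesis, but only for `y ≤ x`, i.e. a tree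
based at a CORNER); the logarithm bound is (26) p. 22 of [3], *"|log X| ≤ … ≤ 2|X − 1|"* for `|X − 1| ≤ ½`
(`MatrixLog.norm_mlog_le_two_mul`, unit f1).

WHAT IS REPRODUCED (0 sorry).  The sentence "These last conditions imply (1.129)" and the inequality of (1.137),
for a tree based at a CENTER `y` of the cube — i.e. for `x − y` of ARBITRARY SIGNS, where the tree contour `Γ_{y,x}`
(B5 (1.7), `B7Prop1Explicit.treeWord`) has backward bonds — under the plaquette hypothesis ONLY ON THE CUBE:
* §1 `axialGauge_eq` / `gaugeAct_eq_conj_axial`: ANY gauge copy `W^u` with `W^u(Γ_{y,x}) = 1` on the cube has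
  `u(x) = u(y)·W(Γ_{y,x})` there, so its bond variables are those of THE axial gauge `W^{v₀}` (`axialFn`) conjugated
  by the constant `u(y)` — "`|·− 1|`" is unchanged for `u(y) ∈ U1` (print fixes the gauge only up to this constant);
* §2 letter bookkeeping: every partial displacement of the tree word of `v` lies in the box `[0 ⊓ v, 0 ⊔ v]`
  coordinatewise (`disp_prefix_treeWord_mem`), whence every elementary loop met by the non-abelian Stokes ladder of
  `axial_bond_eq_sharp` has its corners in `[x ⊓ w, x ⊔ w + e_μ]`, `w = x − lowPart μ (x − y)` (coordinates of `y`
  below `μ`, of `x` from `μ` on);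
* §3 `axial_bond_bound_centered`: `|W^{v₀}(x, x + e_μ) − 1| ≤ (Σ_{κ<μ}|x_κ − y_κ|)·a` assuming `|W(∂p) − 1| ≤ a` only
  for plaquettes inside `[lo, hi] ⊇ [x ⊓ w, x ⊔ w + e_μ]` — NO order relation between `x` and `y`; the friendly
  form `axial_bond_bound_box` (`lo ≤ x, y`; `x + e_μ, y ≤ hi`) and the cube arithmetic `l1_sub_le_of_radius`
  (`|x − y|₁ ≤ d·h` when every face of `[lo, hi]` is within `h` of `y`);
* §4 the printed lines: `ineq129` — for `W = Ū₀ᵏ` with (1.128) at `j = k` on □̃^{(k)} (`a = 2α₀L²`, `Lᵏη = 1`) and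
  any `u` with the global axial conditions on □̃^{(k)}: `|W^u(x,x′) − 1| ≤ |x − y|₁·2L²α₀ ≤ (M + 4R₁M₁)dL²α₀`
  whenever `2h ≤ M + 4R₁M₁` (`h` = the largest distance from `y` to a face, `y` "a center"); `ineq137_bond`,
  `ineq137_log`, `ineq137_log_printed` — on □^{(k)} (`a = 2α₀`, `2h ≤ M`): `|W^u(x,x′) − 1| ≤ |x − y|₁·2α₀ ≤ dMα₀` and,
  for `dMα₀ ≤ ½`, `|(1/i) log W^u(x,x′)| ≤ |x − y|₁·4α₀ ≤ 2dMα₀` (`|x − y|` = the `ℓ¹` distance `B7Prop1Explicit.l1`,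
  the reading under which the printed right-hand members `(M + 4R₁M₁)d·L²α₀`, `2dMα₀` are exactly `d × (half-side) ×`
  the bond constant; here with `≤` for the printed `<`, formally from `≤`-hypotheses);
* §5 the EDGE to Proposition 2 of [3] in the tree: on the GLOBAL `ℤ^d` model (every level `Ω^{(j)} = ℤ^d`, no
  `{Ω_j}`), `B7Prop2Explicit.prop2_explicit_lt_two` (`|Ū^k(∂p) − 1| < 2α₀` from `|U(∂p) − 1| < α₀L^{−2k}`, i.e. (1.7) at
  `j = k` with `η = L^{−k}`) feeds `axial_bond_bound_centered` directly: `ineq137_of_prop2` (any admissible gauge group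
  `AvgClosed G`), `ineq137_unitary` (the unitary group of a C⋆-algebra, `U(N) ⊂ M_N(ℂ)` included).

HONEST SCOPE / NOT TYPED.  (i) (1.128) itself on the LOCAL carrier (a configuration on □₀ ⊃ □̃ only, the collar
arithmetic of p. 98, `B8.sectF_collar_margin`) is a HYPOTHESIS here (`PlaqSmall W lo hi (2α₀L²)`): the tree's Prop. 2
of [3] is the global-carrier one (§5 is the edge in that model; the factor `L²` of (1.128) is (1.7) on `Ω_{k−1} ⊃ □̃`,
i.e. Prop. 2 run with `α₀L²` for `α₀`).  (ii) The fine-lattice half of the gauge fixing ("U₀′ satisfies the axial gauge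
conditions (1.15)") and the identification `Q_k(ηA) = (1/i) log Ū₀′ᵏ` of (1.137) are not typed (they concern the
`η`-lattice field, not the `k`-lattice bond variables bounded here); nor are (1.130)–(1.136), (1.138) (the abstract
`B8.Prop6Printed` is NOT instantiated — its `GaugedBound` folds all of (1.135)–(1.138)).  (iii) Model: `U1 𝔸`-valued
fields (`‖u‖, ‖u⁻¹‖ ≤ 1`), `𝔸` a normed ring with `‖1‖ = 1` (complete normed `ℂ`-algebra for the logarithm / the
average); "y is a center" enters only through `2h ≤ side`; the cube is any order interval `[lo, hi] ∋ y` of `ℤ^d`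
(`d`-first trees of `B7Prop1Explicit`; other orderings are relabellings).  (iv) `|x − y|` is read as the `ℓ¹` norm
(the sharp count is `Σ_{κ<μ}|x_κ − y_κ| ≤ (d − 1)h`; print's `d` is kept).  Value = kernel certificate of two printed
lines of Sect. F in their own non-commutative setting + one in-tree edge B7 Prop. 2 → B8 (1.137); NOT summit
progress.  Second engine (pure python, random `SU(2)` fields on cubes of `ℤ^d`, `d ∈ {2, 3}`, `y` = center / corners /
random, 60 cases × 2 seeds, ALL OK; the ratio `|W^{v₀}(b) − 1| / ((Σ_{κ<μ}|x_κ − y_κ|)·a)` reaches `1.000`):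
`code/b2b-balaban-b08/g18/ineq129_check.py` (+ `.out`).  Unit `b2b-balaban-b08` gen 18 (journal claim B8-INEQ129-CENTERED-AXIAL; census C-B8-42,
DIVERGENCE D-b08-g18.1).
-/

noncomputable section

open scoped BigOperators
open NormedSpace Finset

namespace Literature.MathematicalPhysics.QuantumFieldTheory.Balaban1983to89.B8Ineq129

open B7Prop1Explicit B7Prop2Explicit MatrixLog B8Lemma1NonAbelian

-- `Site` alone would resolve to the torus sites of `Setup.lean`; re-export the `ℤ^d` sites of `B7Prop1Explicit`.
export B7Prop1Explicit (Site)

variable {d : ℕ}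

/-! ## §1 The global axial gauge is unique up to the constant `u(y)` -/

section Transport

variable {G : Type*} [Group G]

/-- **p. 98 "Ū₀′ᵏ(Γ_{y,x}) = 1 for x ∈ □̃^{(k)}" determines the gauge up to `u(y)`**: if `W^u(Γ_{y,x}) = 1` then
`u(x) = u(y)·W(Γ_{y,x}) = u(y)·v₀(x)` with `v₀ = axialFn W y` the axial gauge function of [3] p. 24.
[cite: Balaban1985RegularSpaces, p.98 (before (1.129)); Balaban1985Averaging, p.24] -/
theorem axialGauge_eq (W : Site d → Fin d → G) (u : Site d → G) (y x : Site d)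
    (h : hol (gaugeAct u W) y (treeWord (x - y)) = 1) : u x = u y * axialFn W y x := by
  rw [hol_gaugeAct, disp_treeWord, add_sub_cancel, mul_inv_eq_one] at h
  exact h.symm

/-- The bond variables of any gauge copy satisfying the global axial conditions at `x` and `x + e_μ` are those of
THE axial gauge `W^{v₀}` conjugated by the constant `u(y)`. [cite: Balaban1985RegularSpaces, p.98 (before (1.129))] -/
theorem gaugeAct_eq_conj_axial (W : Site d → Fin d → G) (u : Site d → G) (y x : Site d) (μ : Fin d)
    (hx : hol (gaugeAct u W) y (treeWord (x - y)) = 1)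
    (hx' : hol (gaugeAct u W) y (treeWord (x + e μ - y)) = 1) :
    gaugeAct u W x μ = u y * gaugeAct (axialFn W y) W x μ * (u y)⁻¹ := by
  have h1 := axialGauge_eq W u y x hx
  have h2 := axialGauge_eq W u y (x + e μ) hx'
  simp only [gaugeAct, h1, h2, mul_inv_rev, mul_assoc]

end Transport

/-! ## §2 Letter bookkeeping: partial displacements of a tree word stay in the box `[0 ⊓ v, 0 ⊔ v]` -/

/-- `vec_apply` — bookkeeping: the coordinates of the unit step of a letter. [folklore] -/
theorem vec_apply (l : Letter d) (κ : Fin d) :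
    l.vec κ = if l.1 = κ then (if l.2 = true then 1 else -1) else 0 := by
  obtain ⟨ν, b⟩ := l
  cases b
  · simp only [Letter.vec_false, Pi.neg_apply, e_apply, Bool.false_eq_true, ↓reduceIte]
    by_cases h : ν = κ
    · subst h; simp
    · rw [if_neg (Ne.symm h), if_neg h]; simp
  · simp only [Letter.vec_true, e_apply, ↓reduceIte]
    by_cases h : ν = κ
    · subst h; simp
    · rw [if_neg (Ne.symm h), if_neg h]

/-- A word whose `κ`-letters are all forward has `κ`-displacement `≥ 0`. [folklore] -/
theorem disp_apply_nonneg {κ : Fin d} :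
    ∀ {w : List (Letter d)}, (∀ l ∈ w, l.1 = κ → l.2 = true) → 0 ≤ disp w κ
  | [], _ => by simp
  | l :: w, h => by
    have ih := disp_apply_nonneg (w := w) fun l' hl' => h l' (List.mem_cons_of_mem l hl')
    have hl := h l (by simp)
    rw [disp_cons, Pi.add_apply, vec_apply]
    split_ifs with h1 h2
    · linarith
    · exact absurd (hl h1) h2
    · linarith

/-- A word whose `κ`-letters are all backward has `κ`-displacement `≤ 0`. [folklore] -/
theorem disp_apply_nonpos {κ : Fin d} :
    ∀ {w : List (Letter d)}, (∀ l ∈ w, l.1 = κ → l.2 = false) → disp w κ ≤ 0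
  | [], _ => by simp
  | l :: w, h => by
    have ih := disp_apply_nonpos (w := w) fun l' hl' => h l' (List.mem_cons_of_mem l hl')
    have hl := h l (by simp)
    rw [disp_cons, Pi.add_apply, vec_apply]
    split_ifs with h1 h2
    · rw [hl h1] at h2; exact absurd h2 (by simp)
    · linarith
    · linarith

/-- In the tree word of `v`, the letters in a direction `κ` with `v_κ ≥ 0` are forward. [folklore] -/
theorem snd_eq_true_of_mem_treeWord {v : Site d} {l : Letter d} (hl : l ∈ treeWord v) (hv : 0 ≤ v l.1) :
    l.2 = true := by
  rw [treeWord, List.mem_flatMap] at hl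
  obtain ⟨κ, -, hκ⟩ := hl
  have h1 := mem_seg hκ
  subst h1
  obtain ⟨n, hn⟩ := Int.eq_ofNat_of_zero_le hv
  rw [hn, seg_natCast, List.mem_replicate] at hκ
  rw [hκ.2]

/-- In the tree word of `v`, the letters in a direction `κ` with `v_κ ≤ 0` are backward. [folklore] -/
theorem snd_eq_false_of_mem_treeWord {v : Site d} {l : Letter d} (hl : l ∈ treeWord v) (hv : v l.1 ≤ 0) :
    l.2 = false := by
  rw [treeWord, List.mem_flatMap] at hl
  obtain ⟨κ, -, hκ⟩ := hl
  have h1 := mem_seg hκ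
  subst h1
  obtain ⟨n, hn⟩ := Int.exists_eq_neg_ofNat hv
  rw [hn, seg_neg_natCast, List.mem_replicate] at hκ
  rw [hκ.2]

/-- **Position bookkeeping for tree contours with backward bonds**: every prefix `P` of the tree word of `v`
(`treeWord v = P ++ S`) has displacement in the box `[0 ⊓ v, 0 ⊔ v]`, coordinate by coordinate — the broken line
`Γ_{y, y+v}` of B5 (1.7) never leaves the lattice box spanned by its end-points. [folklore] -/
theorem disp_prefix_treeWord_mem (v : Site d) {P S : List (Letter d)} (h : treeWord v = P ++ S) (κ : Fin d) :
    min 0 (v κ) ≤ disp P κ ∧ disp P κ ≤ max 0 (v κ) := by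
  have hsum : disp P κ + disp S κ = v κ := by
    have := congrArg (fun w : List (Letter d) => disp w κ) h
    simp only [disp_treeWord, disp_append, Pi.add_apply] at this
    exact this.symm
  have hP : ∀ l ∈ P, l ∈ treeWord v := fun l hl => by rw [h]; exact List.mem_append_left S hl
  have hS : ∀ l ∈ S, l ∈ treeWord v := fun l hl => by rw [h]; exact List.mem_append_right P hl
  rcases le_total 0 (v κ) with hv | hv
  · have h1 : 0 ≤ disp P κ := disp_apply_nonneg fun l hl hlκ =>
      snd_eq_true_of_mem_treeWord (hP l hl) (by rw [hlκ]; exact hv)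
    have h2 : 0 ≤ disp S κ := disp_apply_nonneg fun l hl hlκ =>
      snd_eq_true_of_mem_treeWord (hS l hl) (by rw [hlκ]; exact hv)
    constructor <;> omega
  · have h1 : disp P κ ≤ 0 := disp_apply_nonpos fun l hl hlκ =>
      snd_eq_false_of_mem_treeWord (hP l hl) (by rw [hlκ]; exact hv)
    have h2 : disp S κ ≤ 0 := disp_apply_nonpos fun l hl hlκ =>
      snd_eq_false_of_mem_treeWord (hS l hl) (by rw [hlκ]; exact hv)
    constructor <;> omega

/-- `coord_box` — one-coordinate arithmetic: a point `W + D` with `D ∈ [0 ⊓ Lo, 0 ⊔ Lo]` lies in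
`[(W + Lo) ⊓ W, (W + Lo) ⊔ W]`. [folklore] -/
theorem coord_box (W Lo D : ℤ) (h1 : min 0 Lo ≤ D) (h2 : D ≤ max 0 Lo) :
    min (W + Lo) W ≤ W + D ∧ W + D ≤ max (W + Lo) W := by
  constructor <;> omega

/-- `l1_lowPart_le` — bookkeeping: `Σ_{κ<μ}|v_κ| ≤ |v|₁`. [folklore] -/
theorem l1_lowPart_le (μ : Fin d) (v : Site d) : l1 (lowPart μ v) ≤ l1 v := by
  unfold l1
  refine Finset.sum_le_sum fun κ _ => ?_
  simp only [lowPart_apply]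
  split_ifs <;> simp

/-! ## §3 The bond bound in the axial gauge based ANYWHERE, under a LOCAL plaquette hypothesis -/

section Local

variable {𝔸 : Type*} [NormedRing 𝔸] [NormOneClass 𝔸]

/-- The elementary loop of a letter `l = ±e_κ` (`κ ≠ μ`) at `p` is a plaquette — at `p` for `+e_κ`, the conjugated
inverse plaquette at `p − e_κ` for `−e_κ` — with corners among `p, p + l, p + e_μ, p + l + e_μ`; so it obeys the LOCAL
bound `PlaqSmall V lo hi a` as soon as these four points lie in `[lo, hi]`. [folklore] -/
theorem norm_hol_lplaqWord_sub_one_le_local (V : Site d → Fin d → 𝔸ˣ) (hV : ∀ x κ, V x κ ∈ U1 𝔸)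
    {lo hi : Site d} {a : ℝ} (hP : B8Lemma1NonAbelian.PlaqSmall V lo hi a) (p : Site d) (l : Letter d) (μ : Fin d) (hl : l.1 ≠ μ)
    (h1 : lo ≤ p) (h2 : lo ≤ p + l.vec) (h3 : p + e μ ≤ hi) (h4 : p + l.vec + e μ ≤ hi) :
    ‖((hol V p (lplaqWord l μ) : 𝔸ˣ) : 𝔸) - 1‖ ≤ a := by
  obtain ⟨κ, b⟩ := l
  cases b
  · -- backward letter: conjugated inverse plaquette at `p - e κ`
    have hid : hol V p (lplaqWord (κ, false) μ) =
        (V (p - e κ) κ)⁻¹ * (hol V (p - e κ) (plaqWord κ μ))⁻¹ * V (p - e κ) κ := by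
      simp only [lplaqWord, plaqWord, hol_cons, hol_nil, mul_one, stepHol_true, stepHol_false, Letter.rev_mk,
        Bool.not_false, Letter.vec_true, Letter.vec_false, mul_inv_rev, inv_inv]
      abel_nf
      group
    rw [hid, Units.val_mul, Units.val_mul]
    refine (norm_units_inv_conj_sub_one_le (hV _ _) _).trans ?_
    refine (norm_inv_sub_one_le (hol_mem hV _ _)).trans (hP _ κ μ hl ?_ ?_)
    · simpa [sub_eq_add_neg] using h2
    · simpa using h3
  · rw [lplaqWord_true]
    exact hP p κ μ hl h1 (by simpa using h4)

/-- **The bond bound in the axial gauge based at an ARBITRARY point `y`, local form** ([Balaban1985Averaging]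
p. 24 l. −2 – p. 25 l. 3 "`V₀(x, x + e₁) = 1`, `|V₀(x, x + e₂) − 1| < |x₁ − y₁|α₀, …`", as used in
[Balaban1985RegularSpaces] p. 98 with `y` a CENTER of the cube): with `w = x − lowPart μ (x − y)`,
`|V₀(x, x + e_μ) − 1| ≤ (Σ_{κ<μ}|x_κ − y_κ|)·a`, assuming `|V(∂p) − 1| ≤ a` only for the plaquettes inside
`[lo, hi] ⊇ [x ⊓ w, x ⊔ w + e_μ]`; NO order relation between `x` and `y` (for `y ≤ x` this is the lineage's
`B8Lemma1NonAbelian.axial_bond_bound_sharp`). [cite: Balaban1985RegularSpaces, p.98 (1.129); Balaban1985Averaging, pp.24–25] -/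
theorem axial_bond_bound_centered (V : Site d → Fin d → 𝔸ˣ) (hV : ∀ x κ, V x κ ∈ U1 𝔸) {lo hi : Site d} {a : ℝ}
    (hP : B8Lemma1NonAbelian.PlaqSmall V lo hi a) (y x : Site d) (μ : Fin d)
    (hlo : lo ≤ x ⊓ (x - lowPart μ (x - y))) (hhi : x ⊔ (x - lowPart μ (x - y)) + e μ ≤ hi) :
    ‖((gaugeAct (axialFn V y) V x μ : 𝔸ˣ) : 𝔸) - 1‖ ≤ l1 (lowPart μ (x - y)) * a := by
  set V₀ := gaugeAct (axialFn V y) V with hV₀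
  have hV₀m : ∀ x κ, V₀ x κ ∈ U1 𝔸 := gaugeAct_mem hV (axialFn_mem hV y)
  set Lo : Site d := lowPart μ (x - y) with hLo
  set w : Site d := x - Lo with hw
  set Q : List (Letter d) := treeWord Lo with hQ
  have hxw : x = w + Lo := by rw [hw, sub_add_cancel]
  have hid := axial_bond_eq_sharp V y x μ
  rw [← hV₀, ← hLo, ← hw, ← hQ] at hid
  have hQμ : ∀ l ∈ Q, l.1 ≠ μ := by
    intro l hl hlμ
    have h0 := ne_zero_of_mem_treeWord hl
    rw [hlμ, hLo, lowPart_apply, if_neg (lt_irrefl μ)] at h0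
    exact h0 rfl
  -- every position reached along `Q` from `w` (a prefix displacement) gives a plaquette base/top inside `[lo, hi]`
  have hbox : ∀ P S : List (Letter d), Q = P ++ S → lo ≤ w + disp P ∧ w + disp P + e μ ≤ hi := by
    intro P S hPS
    have hPS' : treeWord Lo = P ++ S := by rw [← hQ]; exact hPS
    constructor
    · intro κ
      have hk := disp_prefix_treeWord_mem Lo hPS' κ
      have hb := (coord_box (w κ) (Lo κ) (disp P κ) hk.1 hk.2).1
      have hloκ : lo κ ≤ (x ⊓ w) κ := hlo κ
      have hxκ : x κ = w κ + Lo κ := by rw [hxw]; rfl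
      simp only [Pi.inf_apply, Pi.add_apply] at hloκ ⊢
      omega
    · intro κ
      have hk := disp_prefix_treeWord_mem Lo hPS' κ
      have hb := (coord_box (w κ) (Lo κ) (disp P κ) hk.1 hk.2).2
      have hhiκ : (x ⊔ w + e μ) κ ≤ hi κ := hhi κ
      have hxκ : x κ = w κ + Lo κ := by rw [hxw]; rfl
      simp only [Pi.sup_apply, Pi.add_apply] at hhiκ ⊢
      omega
  have hP' : ∀ (w₁ w₂ : List (Letter d)) (l : Letter d), Q = w₁ ++ l :: w₂ →
      ‖((hol V₀ (w + disp w₁) (lplaqWord l μ) : 𝔸ˣ) : 𝔸) - 1‖ ≤ a := by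
    intro w₁ w₂ l hsplit
    have hl : l ∈ Q := by rw [hsplit]; simp
    have hκμ : l.1 ≠ μ := hQμ l hl
    have hb1 := hbox w₁ (l :: w₂) hsplit
    have hb2 := hbox (w₁ ++ [l]) w₂ (by rw [hsplit, List.append_assoc]; rfl)
    rw [disp_append, disp_cons, disp_nil, add_zero, ← add_assoc] at hb2
    rw [hV₀, hol_gaugeAct_closed _ _ _ _ (disp_lplaqWord l μ), Units.val_mul, Units.val_mul]
    refine (norm_units_conj_sub_one_le (axialFn_mem hV y _) _).trans ?_
    exact norm_hol_lplaqWord_sub_one_le_local V hV hP _ l μ hκμ hb1.1 hb2.1 hb1.2 hb2.2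
  have hlad := ladder_bound_local V₀ hV₀m μ Q w hQμ hP'
  rw [hid, Units.val_mul, Units.val_mul]
  refine (norm_units_inv_conj_sub_one_le (hol_mem hV₀m _ _) _).trans (hlad.trans (le_of_eq ?_))
  rw [hQ, length_treeWord]

omit [NormOneClass 𝔸] in
/-- `le_of_add_e_le` — bookkeeping: `x + e_μ ≤ hi → x ≤ hi`. [folklore] -/
theorem le_of_add_e_le {x hi : Site d} {μ : Fin d} (h : x + e μ ≤ hi) : x ≤ hi :=
  le_trans (le_add_of_nonneg_right (e_nonneg μ)) h

omit [NormOneClass 𝔸] in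
/-- `box_of_mem` — bookkeeping: if `x`, `y` lie in `[lo, hi]` and `x + e_μ ≤ hi`, the box hypotheses of
`axial_bond_bound_centered` hold (`w` has the coordinates of `y` below `μ` and of `x` from `μ` on). [folklore] -/
theorem box_of_mem {lo hi : Site d} (x y : Site d) (μ : Fin d) (hx : lo ≤ x) (hy : lo ≤ y) (hx' : x + e μ ≤ hi)
    (hy' : y ≤ hi) : lo ≤ x ⊓ (x - lowPart μ (x - y)) ∧ x ⊔ (x - lowPart μ (x - y)) + e μ ≤ hi := by
  -- the coordinates of `w = x - lowPart μ (x - y)`: those of `y` below `μ`, those of `x` from `μ` on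
  have hw : ∀ κ, (x - lowPart μ (x - y)) κ = if κ < μ then y κ else x κ := fun κ => by
    simp only [Pi.sub_apply, lowPart_apply]
    split_ifs
    · rw [sub_sub_cancel]
    · rw [sub_zero]
  constructor
  · intro κ
    have h1 : lo κ ≤ x κ := hx κ
    have h2 : lo κ ≤ y κ := hy κ
    rw [Pi.inf_apply, hw κ]
    split_ifs
    · exact le_inf h1 h2
    · exact le_inf h1 h1
  · intro κ
    have h1 : x κ + e μ κ ≤ hi κ := hx' κ
    have h2 : y κ ≤ hi κ := hy' κ
    have h3 : x κ ≤ hi κ := le_of_add_e_le hx' κ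
    rw [Pi.add_apply, Pi.sup_apply, hw κ]
    by_cases hκ : κ = μ
    · subst hκ
      rw [if_neg (lt_irrefl κ), sup_idem]
      exact h1
    · rw [e_apply_of_ne hκ, add_zero]
      split_ifs
      · exact sup_le h3 h2
      · exact sup_le h3 h3

/-- **The bond bound in the axial gauge based at any `y` of a box `[lo, hi]`**: for `x, y ∈ [lo, hi]` with
`x + e_μ ≤ hi` and `|V(∂p) − 1| ≤ a` for the plaquettes inside the box,
`|V₀(x, x + e_μ) − 1| ≤ (Σ_{κ<μ}|x_κ − y_κ|)·a ≤ |x − y|₁·a`. [cite: Balaban1985RegularSpaces, p.98 (1.129); Balaban1985Averaging, pp.24–25] -/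
theorem axial_bond_bound_box (V : Site d → Fin d → 𝔸ˣ) (hV : ∀ x κ, V x κ ∈ U1 𝔸) {lo hi : Site d} {a : ℝ}
    (hP : B8Lemma1NonAbelian.PlaqSmall V lo hi a) (ha : 0 ≤ a) (y x : Site d) (μ : Fin d) (hx : lo ≤ x) (hy : lo ≤ y)
    (hx' : x + e μ ≤ hi) (hy' : y ≤ hi) :
    ‖((gaugeAct (axialFn V y) V x μ : 𝔸ˣ) : 𝔸) - 1‖ ≤ l1 (lowPart μ (x - y)) * a ∧
      (l1 (lowPart μ (x - y)) : ℝ) * a ≤ l1 (x - y) * a := by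
  have hb := box_of_mem x y μ hx hy hx' hy'
  refine ⟨axial_bond_bound_centered V hV hP y x μ hb.1 hb.2, mul_le_mul_of_nonneg_right ?_ ha⟩
  exact_mod_cast l1_lowPart_le μ (x - y)

/-- **Cube arithmetic** ("y is a center of □̃^{(k)}", p. 98): if every face of `[lo, hi]` is within `h` of `y`, then
`|x − y|₁ ≤ d·h` for `x ∈ [lo, hi]`. [folklore] -/
theorem l1_sub_le_of_radius {lo hi y x : Site d} {h : ℕ} (hrad : ∀ κ, y κ - lo κ ≤ h ∧ hi κ - y κ ≤ h)
    (hx : lo ≤ x) (hx' : x ≤ hi) : l1 (x - y) ≤ d * h := by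
  unfold l1
  calc ∑ κ, ((x - y) κ).natAbs ≤ ∑ _κ : Fin d, h := Finset.sum_le_sum fun κ _ => by
          have h1 := hrad κ; have h2 : lo κ ≤ x κ := hx κ; have h3 : x κ ≤ hi κ := hx' κ
          rw [Pi.sub_apply]
          omega
    _ = d * h := by simp

/-! ## §4 The printed lines (1.129) and (1.137) -/

/-- **(1.129), p. 98**: *"Ū₀′ᵏ(Γ_{y,x}) = 1 for x ∈ □̃^{(k)}, where y is a center of □̃^{(k)}. These last conditions
imply |Ū₀′ᵏ(x, x′) − 1| < |x − y|2L²α₀ ≤ (M + 4R₁M₁)dL²α₀, ⟨x, x′⟩ ⊂ □̃^{(k)}. (1.129)"* — for `W = Ū₀ᵏ` on the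
`k`-lattice cube `□̃^{(k)} = [lo, hi] ∋ y` with the plaquette input (1.128) at `j = k` (`|W(∂p) − 1| ≤ 2α₀L²`,
`Lᵏη = 1`), ANY gauge transformation `u` (values in `U1` at `y`) with `W^u(Γ_{y,z}) = 1` for `z ∈ [lo, hi]`, every
face of the cube within `h` of `y` and `2h ≤ M + 4R₁M₁` (its side): `|W^u(x, x + e_μ) − 1| ≤ |x − y|₁·2L²α₀ ≤
(M + 4R₁M₁)dL²α₀` for `⟨x, x + e_μ⟩ ⊂ [lo, hi]`. [cite: Balaban1985RegularSpaces, (1.128)–(1.129) p.98] -/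
theorem ineq129 (W : Site d → Fin d → 𝔸ˣ) (hW : ∀ x κ, W x κ ∈ U1 𝔸) {lo hi y : Site d} {h : ℕ}
    (hy : lo ≤ y) (hy' : y ≤ hi) (hrad : ∀ κ, y κ - lo κ ≤ h ∧ hi κ - y κ ≤ h)
    {L α₀ : ℝ} (hα : 0 ≤ α₀) (h128 : B8Lemma1NonAbelian.PlaqSmall W lo hi (2 * α₀ * L ^ 2))
    (u : Site d → 𝔸ˣ) (hu : u y ∈ U1 𝔸)
    (hax : ∀ z, lo ≤ z → z ≤ hi → hol (gaugeAct u W) y (treeWord (z - y)) = 1)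
    {M R₁ M₁ : ℝ} (hside : 2 * (h : ℝ) ≤ M + 4 * R₁ * M₁)
    (x : Site d) (μ : Fin d) (hx : lo ≤ x) (hx' : x + e μ ≤ hi) :
    ‖((gaugeAct u W x μ : 𝔸ˣ) : 𝔸) - 1‖ ≤ l1 (x - y) * (2 * L ^ 2 * α₀) ∧
      (l1 (x - y) : ℝ) * (2 * L ^ 2 * α₀) ≤ (M + 4 * R₁ * M₁) * d * L ^ 2 * α₀ := by
  have hxhi : x ≤ hi := le_of_add_e_le hx'
  have ha : 0 ≤ 2 * α₀ * L ^ 2 := by positivity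
  have hconj := gaugeAct_eq_conj_axial W u y x μ (hax x hx hxhi)
    (hax (x + e μ) (hx.trans (le_add_of_nonneg_right (e_nonneg μ))) hx')
  have hb := axial_bond_bound_box W hW h128 ha y x μ hx hy hx' hy'
  have hl1 : (l1 (x - y) : ℝ) ≤ d * h := by exact_mod_cast l1_sub_le_of_radius hrad hx hxhi
  constructor
  · rw [hconj, Units.val_mul, Units.val_mul]
    refine (norm_units_conj_sub_one_le hu _).trans (hb.1.trans (hb.2.trans (le_of_eq ?_)))
    ring
  · calc (l1 (x - y) : ℝ) * (2 * L ^ 2 * α₀) ≤ (d * h) * (2 * L ^ 2 * α₀) :=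
          mul_le_mul_of_nonneg_right hl1 (by positivity)
      _ = (2 * (h : ℝ)) * d * L ^ 2 * α₀ := by ring
      _ ≤ (M + 4 * R₁ * M₁) * d * L ^ 2 * α₀ := by
          have : 0 ≤ (d : ℝ) * L ^ 2 * α₀ := by positivity
          nlinarith

/-- **(1.129) in THE gauge of p. 98**: the axial gauge function `v₀ = axialFn W y` of [3] p. 24 does satisfy the
global axial conditions `W^{v₀}(Γ_{y,z}) = 1` for every `z` (`B7Prop1Explicit.hol_axial_treeWord`) with `v₀(y) = 1`,
so the hypotheses `hu`, `hax` of `ineq129` are met (non-vacuity) and (1.129) holds for `Ū₀′ᵏ = W^{v₀}`.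
[cite: Balaban1985RegularSpaces, (1.128)–(1.129) p.98; Balaban1985Averaging, p.24] -/
theorem ineq129_axialFn (W : Site d → Fin d → 𝔸ˣ) (hW : ∀ x κ, W x κ ∈ U1 𝔸) {lo hi y : Site d} {h : ℕ}
    (hy : lo ≤ y) (hy' : y ≤ hi) (hrad : ∀ κ, y κ - lo κ ≤ h ∧ hi κ - y κ ≤ h)
    {L α₀ : ℝ} (hα : 0 ≤ α₀) (h128 : B8Lemma1NonAbelian.PlaqSmall W lo hi (2 * α₀ * L ^ 2))
    {M R₁ M₁ : ℝ} (hside : 2 * (h : ℝ) ≤ M + 4 * R₁ * M₁)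
    (x : Site d) (μ : Fin d) (hx : lo ≤ x) (hx' : x + e μ ≤ hi) :
    ‖((gaugeAct (axialFn W y) W x μ : 𝔸ˣ) : 𝔸) - 1‖ ≤ l1 (x - y) * (2 * L ^ 2 * α₀) ∧
      (l1 (x - y) : ℝ) * (2 * L ^ 2 * α₀) ≤ (M + 4 * R₁ * M₁) * d * L ^ 2 * α₀ :=
  ineq129 W hW hy hy' hrad hα h128 (axialFn W y) (axialFn_mem hW y y)
    (fun z _ _ => hol_axial_treeWord W y (z - y)) hside x μ hx hx'

/-- **(1.137), bond form, p. 99** (Prop. 6): on `□^{(k)} = [lo, hi] ∋ y` (side `M`, `2h ≤ M`, `□ ⊂ Ω_k` so that the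
plaquette input is `|W(∂p) − 1| ≤ 2α₀`), for any gauge copy with the global axial conditions on the cube:
`|W^u(x, x + e_μ) − 1| ≤ |x − y|₁·2α₀ ≤ dMα₀`. [cite: Balaban1985RegularSpaces, Prop. 6 (1.137) p.99] -/
theorem ineq137_bond (W : Site d → Fin d → 𝔸ˣ) (hW : ∀ x κ, W x κ ∈ U1 𝔸) {lo hi y : Site d} {h : ℕ}
    (hy : lo ≤ y) (hy' : y ≤ hi) (hrad : ∀ κ, y κ - lo κ ≤ h ∧ hi κ - y κ ≤ h)
    {α₀ : ℝ} (hα : 0 ≤ α₀) (h128 : B8Lemma1NonAbelian.PlaqSmall W lo hi (2 * α₀))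
    (u : Site d → 𝔸ˣ) (hu : u y ∈ U1 𝔸)
    (hax : ∀ z, lo ≤ z → z ≤ hi → hol (gaugeAct u W) y (treeWord (z - y)) = 1)
    {M : ℝ} (hside : 2 * (h : ℝ) ≤ M) (x : Site d) (μ : Fin d) (hx : lo ≤ x) (hx' : x + e μ ≤ hi) :
    ‖((gaugeAct u W x μ : 𝔸ˣ) : 𝔸) - 1‖ ≤ l1 (x - y) * (2 * α₀) ∧
      (l1 (x - y) : ℝ) * (2 * α₀) ≤ d * M * α₀ := by
  have hxhi : x ≤ hi := le_of_add_e_le hx'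
  have ha : 0 ≤ 2 * α₀ := by positivity
  have hconj := gaugeAct_eq_conj_axial W u y x μ (hax x hx hxhi)
    (hax (x + e μ) (hx.trans (le_add_of_nonneg_right (e_nonneg μ))) hx')
  have hb := axial_bond_bound_box W hW h128 ha y x μ hx hy hx' hy'
  have hl1 : (l1 (x - y) : ℝ) ≤ d * h := by exact_mod_cast l1_sub_le_of_radius hrad hx hxhi
  constructor
  · rw [hconj, Units.val_mul, Units.val_mul]
    exact (norm_units_conj_sub_one_le hu _).trans (hb.1.trans hb.2)
  · calc (l1 (x - y) : ℝ) * (2 * α₀) ≤ (d * h) * (2 * α₀) := mul_le_mul_of_nonneg_right hl1 ha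
      _ = (2 * (h : ℝ)) * d * α₀ := by ring
      _ ≤ M * d * α₀ := by
          have : 0 ≤ (d : ℝ) * α₀ := by positivity
          nlinarith
      _ = d * M * α₀ := by ring

end Local

section Log

variable {𝔸 : Type*} [NormedRing 𝔸] [NormOneClass 𝔸] [NormedAlgebra ℂ 𝔸] [CompleteSpace 𝔸]

/-- **(1.137), logarithmic form, p. 99**: *"|(1/i) log Ū₀′ᵏ(x, x′)| < |x − y|4α₀ ≤ 2dMα₀ for ⟨x, x′⟩ ⊂ □^{(k)}, y is
a center of □"* — from the bond form and (26) of [3], `|log X| ≤ 2|X − 1|` for `|X − 1| ≤ ½` (here guaranteed by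
`dMα₀ ≤ ½`, inside the hypothesis `7dL²Mα₀ ≤ c₁` of Prop. 6 for `c₁ ≤ 7/2`); `log` = the series (21) of [3]
(`MatrixLog.mlog`), the factor `1/i` does not change the norm (`ineq137_log_printed`).
[cite: Balaban1985RegularSpaces, Prop. 6 (1.137) p.99; Balaban1985Averaging, (26) p.22] -/
theorem ineq137_log (W : Site d → Fin d → 𝔸ˣ) (hW : ∀ x κ, W x κ ∈ U1 𝔸) {lo hi y : Site d} {h : ℕ}
    (hy : lo ≤ y) (hy' : y ≤ hi) (hrad : ∀ κ, y κ - lo κ ≤ h ∧ hi κ - y κ ≤ h)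
    {α₀ : ℝ} (hα : 0 ≤ α₀) (h128 : B8Lemma1NonAbelian.PlaqSmall W lo hi (2 * α₀))
    (u : Site d → 𝔸ˣ) (hu : u y ∈ U1 𝔸)
    (hax : ∀ z, lo ≤ z → z ≤ hi → hol (gaugeAct u W) y (treeWord (z - y)) = 1)
    {M : ℝ} (hside : 2 * (h : ℝ) ≤ M) (hsmall : d * M * α₀ ≤ 1 / 2)
    (x : Site d) (μ : Fin d) (hx : lo ≤ x) (hx' : x + e μ ≤ hi) :
    ‖mlog ((gaugeAct u W x μ : 𝔸ˣ) : 𝔸)‖ ≤ l1 (x - y) * (4 * α₀) ∧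
      (l1 (x - y) : ℝ) * (4 * α₀) ≤ 2 * d * M * α₀ := by
  have hb := ineq137_bond W hW hy hy' hrad hα h128 u hu hax hside x μ hx hx'
  have hhalf : ‖((gaugeAct u W x μ : 𝔸ˣ) : 𝔸) - 1‖ ≤ 1 / 2 := hb.1.trans (hb.2.trans hsmall)
  constructor
  · refine (norm_mlog_le_two_mul hhalf).trans ?_
    calc 2 * ‖((gaugeAct u W x μ : 𝔸ˣ) : 𝔸) - 1‖ ≤ 2 * (l1 (x - y) * (2 * α₀)) :=
          mul_le_mul_of_nonneg_left hb.1 (by norm_num)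
      _ = l1 (x - y) * (4 * α₀) := by ring
  · calc (l1 (x - y) : ℝ) * (4 * α₀) = 2 * ((l1 (x - y) : ℝ) * (2 * α₀)) := by ring
      _ ≤ 2 * (d * M * α₀) := mul_le_mul_of_nonneg_left hb.2 (by norm_num)
      _ = 2 * d * M * α₀ := by ring

/-- **(1.137) with the printed `(1/i)`**: `|(1/i) log W^u(x, x + e_μ)| ≤ |x − y|₁·4α₀ ≤ 2dMα₀` (`‖(1/i)·X‖ = ‖X‖`,
cf. `B7BlockAvgLog.norm_Iinv_smul`, not imported to keep this leaf on the B7Prop1/2 + B8Lemma1 spine).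
[cite: Balaban1985RegularSpaces, Prop. 6 (1.137) p.99] -/
theorem ineq137_log_printed (W : Site d → Fin d → 𝔸ˣ) (hW : ∀ x κ, W x κ ∈ U1 𝔸) {lo hi y : Site d} {h : ℕ}
    (hy : lo ≤ y) (hy' : y ≤ hi) (hrad : ∀ κ, y κ - lo κ ≤ h ∧ hi κ - y κ ≤ h)
    {α₀ : ℝ} (hα : 0 ≤ α₀) (h128 : B8Lemma1NonAbelian.PlaqSmall W lo hi (2 * α₀))
    (u : Site d → 𝔸ˣ) (hu : u y ∈ U1 𝔸)
    (hax : ∀ z, lo ≤ z → z ≤ hi → hol (gaugeAct u W) y (treeWord (z - y)) = 1)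
    {M : ℝ} (hside : 2 * (h : ℝ) ≤ M) (hsmall : d * M * α₀ ≤ 1 / 2)
    (x : Site d) (μ : Fin d) (hx : lo ≤ x) (hx' : x + e μ ≤ hi) :
    ‖(Complex.I⁻¹ : ℂ) • mlog ((gaugeAct u W x μ : 𝔸ˣ) : 𝔸)‖ ≤ l1 (x - y) * (4 * α₀) ∧
      (l1 (x - y) : ℝ) * (4 * α₀) ≤ 2 * d * M * α₀ := by
  rw [norm_smul, norm_inv, Complex.norm_I, inv_one, one_mul]
  exact ineq137_log W hW hy hy' hrad hα h128 u hu hax hside hsmall x μ hx hx'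

/-! ## §5 The edge to Proposition 2 of [3] in the tree (global `ℤ^d` model) -/

omit [NormedAlgebra ℂ 𝔸] [CompleteSpace 𝔸] in
/-- A GLOBAL plaquette bound `sup_p |V(∂p) − 1| ≤ a` (`B7Prop2Explicit.pdev`) is in particular the local hypothesis
on every box. [folklore] -/
theorem plaqSmall_of_pdev {V : Site d → Fin d → 𝔸ˣ} (hV : ∀ x κ, V x κ ∈ U1 𝔸) {a : ℝ} (h : pdev V ≤ a)
    (lo hi : Site d) : B8Lemma1NonAbelian.PlaqSmall V lo hi a :=
  fun x κ μ _ _ _ => (le_pdev hV x κ μ).trans h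

/-- **B7 Prop. 2 ⟹ the bond half of (1.137), global model**: if `U` is `G`-valued (`G` closed under the average
(42), `B7Prop2Explicit.AvgClosed`) with `|U(∂p) − 1| < α₀L^{−2k}` on all of `ℤ^d` ((1.7) at `j = k`, `η = L^{−k}`)
and `α₀` is Prop.-1-small, then the `k`-fold average `W = Ū^k` (43) has `|W(∂p) − 1| < 2α₀`
(`prop2_explicit_lt_two`) and hence, in the axial gauge based at ANY `y`, `|W^{v₀}(x, x + e_μ) − 1| ≤
(Σ_{κ<μ}|x_κ − y_κ|)·2α₀ ≤ |x − y|₁·2α₀` for every bond of `ℤ^d`.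
[cite: Balaban1985RegularSpaces, (1.128) p.98, (1.137) p.99; Balaban1985Averaging, Prop. 2 (54) p.26] -/
theorem ineq137_of_prop2 (L : ℕ) (hL : 2 ≤ L) {G : Subgroup 𝔸ˣ} (hG : AvgClosed d L G) (k : ℕ)
    (U : Site d → Fin d → 𝔸ˣ) (hU : ∀ x κ, U x κ ∈ G) {α₀ : ℝ} (hα : 0 < α₀)
    (hα3 : C0 d * α₀ ≤ 1 / 3) (hα2 : 2 * α₀ ≤ c2' d L) (h17 : pdev U < α₀ * (((L : ℝ) ^ k)⁻¹) ^ 2)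
    (y x : Site d) (μ : Fin d) :
    ‖((gaugeAct (axialFn (avgIter L U k) y) (avgIter L U k) x μ : 𝔸ˣ) : 𝔸) - 1‖ ≤
        l1 (lowPart μ (x - y)) * (2 * α₀) ∧
      (l1 (lowPart μ (x - y)) : ℝ) * (2 * α₀) ≤ l1 (x - y) * (2 * α₀) := by
  have hp := prop2_explicit L hL hG k U hU hα hα3 hα2 h17
  have hW : ∀ x κ, avgIter L U k x κ ∈ U1 𝔸 := fun x κ => hG.le_U1 (hp.2 k le_rfl x κ)
  have h2 := prop2_explicit_lt_two L hL hG k U hU hα hα3 hα2 h17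
  refine ⟨axial_bond_bound_centered _ hW (plaqSmall_of_pdev hW h2.le (x ⊓ (x - lowPart μ (x - y)))
    (x ⊔ (x - lowPart μ (x - y)) + e μ)) y x μ le_rfl le_rfl, ?_⟩
  exact mul_le_mul_of_nonneg_right (by exact_mod_cast l1_lowPart_le μ (x - y)) (by positivity)

end Log

/-! ### Dictionary entry: the unitary group of a C⋆-algebra (`U(N) ⊂ M_N(ℂ)` included) -/

section Unitary

variable {𝔸 : Type*} [CStarAlgebra 𝔸] [Nontrivial 𝔸]

/-- **(1.137), bond half, for `U(N)`-type gauge groups on the global model**: `ineq137_of_prop2` for configurations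
with values in the unitary group of a C⋆-algebra (`B7Prop2Explicit.avgClosed_unitaryUnits`).
[cite: Balaban1985RegularSpaces, (1.137) p.99; Balaban1985Averaging, Prop. 2 (54) p.26] -/
theorem ineq137_unitary (L : ℕ) (hL : 2 ≤ L) (k : ℕ) (U : Site d → Fin d → 𝔸ˣ)
    (hU : ∀ x κ, U x κ ∈ unitaryUnits 𝔸) {α₀ : ℝ} (hα : 0 < α₀) (hα3 : C0 d * α₀ ≤ 1 / 3)
    (hα2 : 2 * α₀ ≤ c2' d L) (h17 : pdev U < α₀ * (((L : ℝ) ^ k)⁻¹) ^ 2) (y x : Site d) (μ : Fin d) :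
    ‖((gaugeAct (axialFn (avgIter L U k) y) (avgIter L U k) x μ : 𝔸ˣ) : 𝔸) - 1‖ ≤ l1 (x - y) * (2 * α₀) := by
  have h := ineq137_of_prop2 L hL (avgClosed_unitaryUnits d L) k U hU hα hα3 hα2 h17 y x μ
  exact h.1.trans h.2

end Unitary

/-! ## Axiom audit (gate whitelist: `propext`, `Classical.choice`, `Quot.sound`) -/

#print axioms axial_bond_bound_centered
#print axioms ineq129
#print axioms ineq137_log_printed
#print axioms ineq137_of_prop2
#print axioms ineq137_unitary

end Literature.MathematicalPhysics.QuantumFieldTheory.Balaban1983to89.B8Ineq129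

end
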